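import Mathlib
import HarnessLib
import Summits.AtomisticToContinuum.Crystallization.Theorems.PricedLinkCensusSoftFourRingsRigCellSound1

/-!
# Soft four-rings, metric half by certified numerics (9): the normal-form frame

Route `PricedLinkCensus`, sub-problem `Crystallization`, item `SoftFourRings`
(stmt-AtomisticToContinuum-14234).  For a labelled configuration `p : Fin 12 → ℝ³` of unit
vectors obeying the one-percent windows of a well-formed model, the normal-form frame (an
orthonormal basis `e₁, e₂, e₃ = p r0` with `p r1 ∈ span(e₃, e₁)`, `⟪e₁, p r1⟫ ≥ 0`,
`⟪e₂, p r2⟫ ≥ 0`), the coordinates `X i k = ⟪e_k, p i⟫` in it, and their normal form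
(`InCell` shape) and feasibility (`Feasible m.bond X`).
-/

namespace Summit.AtomisticToContinuum.Crystallization.Theorems

namespace Rig

open Literature.Analysis.ValidatedNumerics.NumericsMP
open scoped Matrix RealInnerProductSpace


/-! ### Inner products and cross products in `ℝ³` -/

/-- The cross product of two vectors of `ℝ³` (as elements of `EuclideanSpace`). -/
def crossE (u v : EuclideanSpace ℝ (Fin 3)) : EuclideanSpace ℝ (Fin 3) :=
  WithLp.toLp 2 ((WithLp.ofLp u) ⨯₃ (WithLp.ofLp v))

/-- `u × v ⊥ u`. -/
theorem inner_crossE_left (u v : EuclideanSpace ℝ (Fin 3)) : ⟪crossE u v, u⟫ = 0 := by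
  rw [EuclideanSpace.inner_eq_star_dotProduct, star_trivial, crossE, WithLp.ofLp_toLp,
    dot_self_cross]

/-- `u × v ⊥ v`. -/
theorem inner_crossE_right (u v : EuclideanSpace ℝ (Fin 3)) : ⟪crossE u v, v⟫ = 0 := by
  rw [EuclideanSpace.inner_eq_star_dotProduct, star_trivial, crossE, WithLp.ofLp_toLp,
    dot_cross_self]

/-- `|u × v|² = |u|²|v|² − ⟪u,v⟫ ⟪v,u⟫`. -/
theorem inner_crossE_self (u v : EuclideanSpace ℝ (Fin 3)) :
    ⟪crossE u v, crossE u v⟫ = ⟪u, u⟫ * ⟪v, v⟫ - ⟪u, v⟫ * ⟪v, u⟫ := by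
  simp only [EuclideanSpace.inner_eq_star_dotProduct, star_trivial, crossE]
  rw [cross_dot_cross]; ring

/-! ### The normal-form frame -/

/-- Frame cosine `g = ⟪p r1, p r0⟫`. -/
noncomputable def fg (m : Model) (p : Fin 12 → EuclideanSpace ℝ (Fin 3)) : ℝ :=
  ⟪p m.r1, p m.r0⟫
/-- `u = p r1 − g p r0`. -/
noncomputable def fu (m : Model) (p : Fin 12 → EuclideanSpace ℝ (Fin 3)) :
    EuclideanSpace ℝ (Fin 3) :=
  p m.r1 - fg m p • p m.r0
/-- `e₁ = u/‖u‖`. -/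
noncomputable def fe1 (m : Model) (p : Fin 12 → EuclideanSpace ℝ (Fin 3)) :
    EuclideanSpace ℝ (Fin 3) :=
  ‖fu m p‖⁻¹ • fu m p
/-- `e₃ × e₁`. -/
noncomputable def fcr (m : Model) (p : Fin 12 → EuclideanSpace ℝ (Fin 3)) :
    EuclideanSpace ℝ (Fin 3) :=
  crossE (p m.r0) (fe1 m p)
/-- The orientation sign making `⟪e₂, p r2⟫ ≥ 0`. -/
noncomputable def fsg (m : Model) (p : Fin 12 → EuclideanSpace ℝ (Fin 3)) : ℝ :=
  if 0 ≤ ⟪fcr m p, p m.r2⟫ then 1 else -1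
/-- `e₂ = ± e₃ × e₁`. -/
noncomputable def fe2 (m : Model) (p : Fin 12 → EuclideanSpace ℝ (Fin 3)) :
    EuclideanSpace ℝ (Fin 3) :=
  fsg m p • fcr m p
/-- **The normal-form frame** `![e₁, e₂, e₃]`. -/
noncomputable def frame (m : Model) (p : Fin 12 → EuclideanSpace ℝ (Fin 3)) :
    Fin 3 → EuclideanSpace ℝ (Fin 3) :=
  ![fe1 m p, fe2 m p, p m.r0]

section Frame

variable {m : Model} {p : Fin 12 → EuclideanSpace ℝ (Fin 3)}

/-- Unit vectors: `⟪p i, p i⟫ = 1`. -/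
theorem inner_self_one (hp1 : ∀ i, ‖p i‖ = 1) (i : Fin 12) : ⟪p i, p i⟫ = 1 := by
  rw [real_inner_self_eq_norm_sq, hp1 i, one_pow]

/-- `g² < 1`. -/
theorem fg_sq_lt_one
    (hW : m.WF) (hall : ∀ i j, i ≠ j → ⟪p i, p j⟫ ≤ chiR)
    (hbond : ∀ i j, i ≠ j → m.bond i j = true → cbloR ≤ ⟪p i, p j⟫) : fg m p ^ 2 < 1 := by
  have h1 := hall m.r1 m.r0 hW.d01.symm
  have h2 := hbond m.r1 m.r0 hW.d01.symm (by rw [hW.symm]; exact hW.b01)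
  rw [chiR] at h1; rw [cbloR] at h2; rw [fg]
  nlinarith

/-- `⟪u, p r0⟫ = 0`. -/
theorem inner_fu_r0 (hp1 : ∀ i, ‖p i‖ = 1) : ⟪fu m p, p m.r0⟫ = 0 := by
  have h0 : ⟪p m.r0, p m.r0⟫ = 1 := inner_self_one hp1 m.r0
  simp only [fu, inner_sub_left, real_inner_smul_left, h0]
  rw [fg]; ring

/-- `⟪u, u⟫ = 1 − g²`. -/
theorem inner_fu_fu (hp1 : ∀ i, ‖p i‖ = 1) : ⟪fu m p, fu m p⟫ = 1 - fg m p ^ 2 := by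
  have h0 : ⟪p m.r0, p m.r0⟫ = 1 := inner_self_one hp1 m.r0
  have h1 : ⟪p m.r1, p m.r1⟫ = 1 := inner_self_one hp1 m.r1
  have hg : ⟪p m.r0, p m.r1⟫ = fg m p := by rw [fg, real_inner_comm]
  have hg' : ⟪p m.r1, p m.r0⟫ = fg m p := rfl
  simp only [fu, inner_sub_left, inner_sub_right, real_inner_smul_left, real_inner_smul_right, h0,
    h1, hg, hg']
  ring

/-- `‖u‖ > 0`. -/
theorem norm_fu_pos
    (hW : m.WF) (hp1 : ∀ i, ‖p i‖ = 1) (hall : ∀ i j, i ≠ j → ⟪p i, p j⟫ ≤ chiR)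
    (hbond : ∀ i j, i ≠ j → m.bond i j = true → cbloR ≤ ⟪p i, p j⟫) : 0 < ‖fu m p‖ := by
  have h : 0 < ⟪fu m p, fu m p⟫ := by
    rw [inner_fu_fu hp1]; nlinarith [fg_sq_lt_one hW hall hbond]
  rw [real_inner_self_eq_norm_sq] at h
  nlinarith [norm_nonneg (fu m p)]

/-- `⟪e₁, e₁⟫ = 1`. -/
theorem inner_fe1_fe1
    (hW : m.WF) (hp1 : ∀ i, ‖p i‖ = 1) (hall : ∀ i j, i ≠ j → ⟪p i, p j⟫ ≤ chiR)
    (hbond : ∀ i j, i ≠ j → m.bond i j = true → cbloR ≤ ⟪p i, p j⟫) : ⟪fe1 m p, fe1 m p⟫ = 1 := by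
  have hpos := norm_fu_pos hW hp1 hall hbond
  rw [fe1, real_inner_smul_left, real_inner_smul_right, real_inner_self_eq_norm_sq]
  field_simp

/-- `⟪e₁, p r0⟫ = 0`. -/
theorem inner_fe1_r0 (hp1 : ∀ i, ‖p i‖ = 1) : ⟪fe1 m p, p m.r0⟫ = 0 := by
  rw [fe1, real_inner_smul_left, inner_fu_r0 hp1, mul_zero]

/-- `p r1 = ‖u‖ e₁ + g p r0`. -/
theorem r1_decomp
    (hW : m.WF) (hp1 : ∀ i, ‖p i‖ = 1) (hall : ∀ i j, i ≠ j → ⟪p i, p j⟫ ≤ chiR)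
    (hbond : ∀ i j, i ≠ j → m.bond i j = true → cbloR ≤ ⟪p i, p j⟫)
    : p m.r1 = ‖fu m p‖ • fe1 m p + fg m p • p m.r0 := by
  have hpos := norm_fu_pos hW hp1 hall hbond
  rw [fe1, smul_smul, mul_inv_cancel₀ hpos.ne', one_smul, fu]; abel

/-- `⟪e₃ × e₁, e₃ × e₁⟫ = 1`. -/
theorem inner_fcr_fcr
    (hW : m.WF) (hp1 : ∀ i, ‖p i‖ = 1) (hall : ∀ i j, i ≠ j → ⟪p i, p j⟫ ≤ chiR)
    (hbond : ∀ i j, i ≠ j → m.bond i j = true → cbloR ≤ ⟪p i, p j⟫) : ⟪fcr m p, fcr m p⟫ = 1 := by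
  rw [fcr, inner_crossE_self, inner_self_one hp1, inner_fe1_fe1 hW hp1 hall hbond,
    real_inner_comm (fe1 m p), inner_fe1_r0 hp1]; ring

/-- `fsg² = 1`. -/
theorem fsg_sq : fsg m p * fsg m p = 1 := by
  unfold fsg; split_ifs <;> norm_num

/-- `⟪e₂, e₂⟫ = 1`. -/
theorem inner_fe2_fe2
    (hW : m.WF) (hp1 : ∀ i, ‖p i‖ = 1) (hall : ∀ i j, i ≠ j → ⟪p i, p j⟫ ≤ chiR)
    (hbond : ∀ i j, i ≠ j → m.bond i j = true → cbloR ≤ ⟪p i, p j⟫) : ⟪fe2 m p, fe2 m p⟫ = 1 := by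
  rw [fe2, real_inner_smul_left, real_inner_smul_right, inner_fcr_fcr hW hp1 hall hbond, mul_one]
  exact fsg_sq

/-- `⟪e₂, p r0⟫ = 0`. -/
theorem inner_fe2_r0 : ⟪fe2 m p, p m.r0⟫ = 0 := by
  rw [fe2, real_inner_smul_left, fcr, inner_crossE_left, mul_zero]

/-- `⟪e₂, e₁⟫ = 0`. -/
theorem inner_fe2_fe1 : ⟪fe2 m p, fe1 m p⟫ = 0 := by
  rw [fe2, real_inner_smul_left, fcr, inner_crossE_right, mul_zero]

/-- `⟪e₂, p r2⟫ ≥ 0`. -/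
theorem inner_fe2_r2_nonneg : 0 ≤ ⟪fe2 m p, p m.r2⟫ := by
  rw [fe2, real_inner_smul_left]
  unfold fsg; split_ifs with h
  · simpa using h
  · push Not at h; nlinarith

/-- **The frame is orthonormal.** -/
theorem frame_orthonormal
    (hW : m.WF) (hp1 : ∀ i, ‖p i‖ = 1) (hall : ∀ i j, i ≠ j → ⟪p i, p j⟫ ≤ chiR)
    (hbond : ∀ i j, i ≠ j → m.bond i j = true → cbloR ≤ ⟪p i, p j⟫)
    : Orthonormal ℝ (frame m p) := by
  have n1 : ‖fe1 m p‖ = 1 := by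
    have h := inner_fe1_fe1 hW hp1 hall hbond
    rw [real_inner_self_eq_norm_sq] at h
    exact (pow_eq_one_iff_of_nonneg (norm_nonneg _) two_ne_zero).1 h
  have n2 : ‖fe2 m p‖ = 1 := by
    have h := inner_fe2_fe2 hW hp1 hall hbond
    rw [real_inner_self_eq_norm_sq] at h
    exact (pow_eq_one_iff_of_nonneg (norm_nonneg _) two_ne_zero).1 h
  have n3 : ‖p m.r0‖ = 1 := hp1 m.r0
  have h13 := inner_fe1_r0 (m := m) hp1
  have h23 := inner_fe2_r0 (m := m) (p := p)
  have h21 := inner_fe2_fe1 (m := m) (p := p)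
  have h31 : ⟪p m.r0, fe1 m p⟫ = 0 := by rw [real_inner_comm]; exact h13
  have h32 : ⟪p m.r0, fe2 m p⟫ = 0 := by rw [real_inner_comm]; exact h23
  have h12 : ⟪fe1 m p, fe2 m p⟫ = 0 := by rw [real_inner_comm]; exact h21
  rw [orthonormal_iff_ite]
  intro i j
  fin_cases i <;> fin_cases j <;>
    simp [frame, n1, n2, n3, h13, h23, h21, h31, h32, h12]

end Frame

/-! ### Coordinates -/

/-- The coordinates of the configuration in the frame: `X i k = ⟪e_k, p i⟫`. -/
noncomputable def coords (m : Model) (p : Fin 12 → EuclideanSpace ℝ (Fin 3)) :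
    Fin 12 → Fin 3 → ℝ :=
  fun i k => ⟪frame m p k, p i⟫

section Coords

variable {m : Model} {p : Fin 12 → EuclideanSpace ℝ (Fin 3)}

/-- The orthonormal basis of the frame. -/
noncomputable def frameBasis (hon : Orthonormal ℝ (frame m p)) :
    OrthonormalBasis (Fin 3) ℝ (EuclideanSpace ℝ (Fin 3)) :=
  (basisOfOrthonormalOfCardEqFinrank hon (by simp)).toOrthonormalBasis
    (by rw [coe_basisOfOrthonormalOfCardEqFinrank]; exact hon)

/-- The frame basis is the frame. -/
theorem frameBasis_apply (hon : Orthonormal ℝ (frame m p)) (k : Fin 3)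
    : frameBasis hon k = frame m p k := by
  rw [frameBasis, Module.Basis.coe_toOrthonormalBasis, coe_basisOfOrthonormalOfCardEqFinrank]

/-- Coordinates are the representation in the frame basis. -/
theorem repr_eq_coords (hon : Orthonormal ℝ (frame m p)) (i : Fin 12) :
    (frameBasis hon).repr (p i) = WithLp.toLp 2 (coords m p i) := by
  ext k
  rw [PiLp.toLp_apply, OrthonormalBasis.repr_apply_apply, frameBasis_apply]
  rfl

/-- **Parseval**: `X i ⬝ X j = ⟪p i, p j⟫`. -/
theorem coords_dot (hon : Orthonormal ℝ (frame m p)) (i j : Fin 12) :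
    coords m p i ⬝ᵥ coords m p j = ⟪p i, p j⟫ := by
  have h := (frameBasis hon).sum_inner_mul_inner (p i) (p j)
  rw [dotProduct, ← h]
  refine Finset.sum_congr rfl fun k _ => ?_
  rw [coords, coords, frameBasis_apply, real_inner_comm (p i)]

/-- **The coordinates are feasible** for the bond relation of the model. -/
theorem feasible_coords
    (hW : m.WF) (hp1 : ∀ i, ‖p i‖ = 1) (hall : ∀ i j, i ≠ j → ⟪p i, p j⟫ ≤ chiR)
    (hbond : ∀ i j, i ≠ j → m.bond i j = true → cbloR ≤ ⟪p i, p j⟫)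
    (hnb : ∀ i j, i ≠ j → m.bond i j = false → ⟪p i, p j⟫ ≤ cnbR)
    : Feasible m.bond (coords m p) := by
  have hon := frame_orthonormal hW hp1 hall hbond
  refine ⟨fun i => ?_, fun i j hij hb => ?_, fun i j hij hb => ?_⟩
  · rw [coords_dot hon, inner_self_one hp1]
  · rw [coords_dot hon]; exact ⟨hbond i j (ne_of_lt hij) hb, hall i j (ne_of_lt hij)⟩
  · rw [coords_dot hon]; exact hnb i j (ne_of_lt hij) hb

/-- The normal-form properties of the coordinates of the frame points. -/
theorem coords_frame_pts
    (hW : m.WF) (hp1 : ∀ i, ‖p i‖ = 1) (hall : ∀ i j, i ≠ j → ⟪p i, p j⟫ ≤ chiR)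
    (hbond : ∀ i j, i ≠ j → m.bond i j = true → cbloR ≤ ⟪p i, p j⟫) :
    coords m p m.r0 = ![0, 0, 1] ∧ coords m p m.r1 1 = 0 ∧ 0 ≤ coords m p m.r1 0 ∧
    0 ≤ coords m p m.r2 1 := by
  have hpos := norm_fu_pos hW hp1 hall hbond
  have hr1 := r1_decomp hW hp1 hall hbond
  refine ⟨?_, ?_, ?_, ?_⟩
  · funext k
    fin_cases k
    · simp [coords, frame, inner_fe1_r0 hp1]
    · simp [coords, frame, inner_fe2_r0]
    · simp [coords, frame, hp1]
  · show ⟪frame m p 1, p m.r1⟫ = 0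
    simp only [frame, Matrix.cons_val_one, Matrix.cons_val_zero]
    rw [hr1, inner_add_right, real_inner_smul_right, real_inner_smul_right, inner_fe2_fe1,
      inner_fe2_r0, mul_zero, mul_zero, add_zero]
  · show 0 ≤ ⟪frame m p 0, p m.r1⟫
    simp only [frame, Matrix.cons_val_zero]
    rw [hr1, inner_add_right, real_inner_smul_right, real_inner_smul_right,
      inner_fe1_fe1 hW hp1 hall hbond, inner_fe1_r0 hp1, mul_one, mul_zero, add_zero]
    exact hpos.le
  · show 0 ≤ ⟪frame m p 1, p m.r2⟫
    simp only [frame, Matrix.cons_val_one, Matrix.cons_val_zero]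
    exact inner_fe2_r2_nonneg

/-- Coordinates of unit vectors are in `[−1, 1]` (given orthonormality). -/
theorem abs_coords_le_one
    (hp1 : ∀ i, ‖p i‖ = 1) (hon : Orthonormal ℝ (frame m p)) (i : Fin 12) (k : Fin 3) :
    |coords m p i k| ≤ 1 := by
  have h : coords m p i ⬝ᵥ coords m p i = 1 := by rw [coords_dot hon, inner_self_one hp1]
  exact Literature.Geometry.Riemannian.HamiltonODE.abs_apply_le_one_of_dot_self h k

end Coords

end Rig

end Summit.AtomisticToContinuum.Crystallization.Theorems
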